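import Mathlib
import HarnessLib
import Summits.HubbardSuperconductivity.HubbardSuperconductivity.Theorems.KLProgrammeKLRegimeAlphaWtBlockTower
import Summits.HubbardSuperconductivity.HubbardSuperconductivity.Theorems.KLProgrammeKLRegimeEngineSliceFamBandTelRegime
import Summits.HubbardSuperconductivity.HubbardSuperconductivity.Theorems.KLProgrammeKLRegimeSplitModelCongr

/-!
# K3 ENGINE child (stmt-HubbardSuperconductivity-20437), stub (b), the LEVELS package (ℓ): **`α_w` AT THE FLOW FRAME `K_n` WITH NO DEPTH WINDOW** —
# the window-free twins of p3's `alphaWt_klSliceCov_bgmFat_klEng_flow_deep` / `alphaWt_blockSliceCT_bgmFat_klEng_flow_deep` /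
# `alphaWt_towerBlock_klEng_flow_deep` (the JOIN (J-α) of the «(b)-Wt-FAMILY-DEEP» cure (F1): p3's deep-window base ∪ k3c3-p2's (D5) telescope)

Cell `gate-hubbard-kl`, seat hubbard-kl-k3c3-p2 (g12).  E1's (I1′) consumer `klWtPinnedSumAt_klTowerIncr_le_klEng` (…EngineTowerBlockIncrWtKlEng) reads the
weighted block rows `hrow/hcol` at the flow frame `klFlowFrameU … n` from p3's `alphaWt_towerBlock_klEng_flow_deep (d d′)`, which carries the deep window
`4^{n+2}·U ≤ 4^{2(dk−1)+d′}` (finding «(b)-Wt-FAMILY-DEEP»: below it the flow frame `K_n`'s order-three datum is too rough for the family scale).  The cure (F1)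
is landed as `alphaWt_klSliceCov_bgmFat_klEng_meanFreeFinal (j d′) (R) (c″)` (…EngineSliceFamBandTelRegime, k3c3-p2 g11): the single-slice rows at the final
mean-free frame `K_n ⊖ Σ_{m ∈ Ico n n}(…)` (same lattice values as `K_n`) from a base index `m₀` with the base window `4^{m₀+2}·U ≤ 4^{2nf+d′}` and the
telescope window `4^{j+4}·16^{nf} ≤ 4^{m₀}`.  This file removes every window from the consumer's view:

* `eval_fsub_symInterp_sum_Ico_self` — `(K ⊖ symInterp (Σ_{m∈Ico n n} …))(p) = K(p)`; hence the (D5) matrices ARE the `K_n` matrices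
  (`nambuXiCT_congr`, `hubbardCovSliceCT_congr` of …SplitModelCongr);
* `exists_base_index_of_not_window` — below the deep window at `d′ := j + 6` the index `m₀ := Nat.findGreatest (4^{·+2}·U ≤ 4^{2nf+j+6}) n` satisfies
  `1 ≤ m₀ ≤ n` and BOTH (D5) windows (pure arithmetic, `U ≤ 1`);
* **`alphaWt_klSliceCov_bgmFat_klEng_flow_all (j) (R) (c″)`** — `∃ Cα > 0`: for every admissible history in the KL regime (`R.WF2`, `0 < cc ≤ klEngC₃6 P R`,
  `μ ∈ klWindowC`, `0 < U ≤ min (klEngU₀3 P R cc) (1/(Gfr₃+1))`, `c″U ≤ 1`, `klBetaMin ≤ β ≤ e^{cc/U²}`, `klEngL₃ ≤ L`, `klEngM₃ ≤ M`, `1 ≤ n ≤ n_β+1`,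
  `IsKLRegime U cc (−n)`, `HistP klPredsV17F2 … 0 n`, the mean-free piece clauses `∀ m < n, FlowPieceOscAt L M c″ β U μ m`) and EVERY `1 ≤ nf`,
  `nf + j ≤ n_β + 1`, `nw ≥ nf + j`: the `klScaleWt nw`-weighted rows and columns of `S(F̃_nf[K_n])ᵀ·klSliceCov K_n (nf+j)·S(F̃_nf[K_n])` are
  `≤ Cα·(M/β)/Λ_{nf+j}` — NO window (case split: p3 on the window, (D5) below it); `Cα = Cα^{deep}(j, j+6) + Cα^{(D5)}(j, j+6, R, c″)`;
* **`alphaWt_blockSliceCT_bgmFat_klEng_flow_all (db) (R) (c″)`** — the thick-slice block `(Λ_{J₂}, Λ_{nf+1}]`, `nf + 1 ≤ J₂ ≤ nf + 1 + db`, any weight level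
  `J′ ≥ nf + 1` (p3's …AlphaWtBlockFlow bookkeeping verbatim over the window-free slices);
* **`alphaWt_towerBlock_klEng_flow_all (d) (R) (c″)`** — the same in the tower's indexing (`nf := dk − 1`, block `(Λ_{d(k+1)}, Λ_{dk}]`, weight `klScaleWt j`,
  `dk ≤ j`): E1's `hrow/hcol` at EVERY block `k ≥ 1` with `2 ≤ dk`, `d(k+1) ≤ n_β + 1`.

The constant now depends on `(R, c″)` (through the telescope's rate constants `Gfr_k/c″`); in 20437's §C this is absorbed by `U₀(R)` (chosen after `R`).
Everything is proved; no definitions; nothing about the model is asserted beyond the landed theorems; nothing asserts superconductivity.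
[cite: BenfattoGiulianiMastropietro2006, §2.8 (2.81), §3 (3.2)–(3.8)]
-/

noncomputable section

namespace Summit.HubbardSuperconductivity.HubbardSuperconductivity.Theorems.TorusFourierL2

set_option linter.dupNamespace false -- summit = problem name (single-conjunct summit), D-0017

open Set Finset Literature.MathematicalPhysics.QuantumLattice Literature.MathematicalPhysics.QuantumLattice.BandSectorCounting
open Literature.MathematicalPhysics.QuantumLattice.FermiRG Literature.Probability.LatticeModels Literature.Analysis.SpecialFunctions
open Summit.HubbardSuperconductivity.HubbardSuperconductivity.Theorems.DispersionFlow
open Summit.HubbardSuperconductivity.HubbardSuperconductivity.Theorems.KLRegimeSplit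
open Summit.HubbardSuperconductivity.HubbardSuperconductivity.Theorems.KLProgrammeLegKernels
open Summit.HubbardSuperconductivity.HubbardSuperconductivity.Theorems.PerturbedFermiCurve
open Summit.HubbardSuperconductivity.HubbardSuperconductivity.Theorems.KLRegimeWick
open Summit.HubbardSuperconductivity.HubbardSuperconductivity.Theorems.EngineV8
open Literature.Probability.LatticeModels.BattleFederbush
open scoped Real Nat

open Classical

/-! ## §1 The final mean-free frame has the flow frame's values; the base index below the window -/

section Frame

variable {L M : ℕ} [NeZero L] [NeZero M]

/-- **`(K ⊖ symInterp (Σ_{m ∈ Ico n n} f m))(p) = K(p)`**: the (D5) final frame `K_n ⊖ 0` has the values of `K_n` (empty sum, constant interpolant). -/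
theorem eval_fsub_symInterp_sum_Ico_self (K : TrigPolyC4v) (f : ℕ → ℝ) (n : ℕ) (p : Fin 2 → ℝ) :
    (fsub K (symInterp L fun _ => ∑ m ∈ Ico n n, f m)).eval p = K.eval p := by
  simp only [Finset.Ico_self, Finset.sum_empty]
  rw [eval_fsub_symInterp_const, sub_zero]

end Frame

/-- **The base index below the deep window** (pure arithmetic): if `U ≤ 1`, `1 ≤ nf`, `1 ≤ n` and the deep window FAILS at `n`
(`¬ 4^{n+2}·U ≤ 4^{2nf+(j+6)}`), then `m₀ := Nat.findGreatest (fun m ↦ 4^{m+2}·U ≤ 4^{2nf+(j+6)}) n` has `1 ≤ m₀ ≤ n`, the base window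
`4^{m₀+2}·U ≤ 4^{2nf+(j+6)}` and the telescope window `4^{j+4}·16^{nf} ≤ 4^{m₀}`. [folklore] -/
theorem exists_base_index_of_not_window {U : ℝ} (hU1 : U ≤ 1) {n nf j : ℕ} (hn : 1 ≤ n) (hnf : 1 ≤ nf)
    (hwin : ¬ (4 : ℝ) ^ (n + 2) * U ≤ (4 : ℝ) ^ (2 * nf + (j + 6))) :
    ∃ m₀ : ℕ, 1 ≤ m₀ ∧ m₀ ≤ n ∧ (4 : ℝ) ^ (m₀ + 2) * U ≤ (4 : ℝ) ^ (2 * nf + (j + 6)) ∧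
      (4 : ℝ) ^ (j + 4) * (16 : ℝ) ^ nf ≤ (4 : ℝ) ^ m₀ := by
  set P : ℕ → Prop := fun m => (4 : ℝ) ^ (m + 2) * U ≤ (4 : ℝ) ^ (2 * nf + (j + 6)) with hP
  have hP1 : P 1 := by
    show (4 : ℝ) ^ (1 + 2) * U ≤ (4 : ℝ) ^ (2 * nf + (j + 6))
    calc (4 : ℝ) ^ (1 + 2) * U ≤ (4 : ℝ) ^ (1 + 2) * 1 := mul_le_mul_of_nonneg_left hU1 (by positivity)
      _ ≤ (4 : ℝ) ^ (2 * nf + (j + 6)) := by rw [mul_one]; exact pow_le_pow_right₀ (by norm_num) (by omega)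
  refine ⟨Nat.findGreatest P n, Nat.le_findGreatest (P := P) hn hP1, Nat.findGreatest_le (P := P) n,
    Nat.findGreatest_spec (P := P) hn hP1, ?_⟩
  -- `m₀ < n` (the window fails at `n`) and `¬ P (m₀ + 1)`
  have hm₀n : Nat.findGreatest P n < n := by
    rcases (Nat.findGreatest_le (P := P) n).lt_or_eq with h | h
    · exact h
    · exact absurd (h ▸ Nat.findGreatest_spec (P := P) hn hP1 : P n) hwin
  have hnot : ¬ P (Nat.findGreatest P n + 1) := Nat.findGreatest_is_greatest (P := P) (Nat.lt_succ_self _) hm₀n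
  -- hence `2nf + j + 6 ≤ m₀ + 2`
  have hle : 2 * nf + (j + 6) ≤ Nat.findGreatest P n + 2 := by
    by_contra hlt
    refine hnot ?_
    show (4 : ℝ) ^ (Nat.findGreatest P n + 1 + 2) * U ≤ (4 : ℝ) ^ (2 * nf + (j + 6))
    calc (4 : ℝ) ^ (Nat.findGreatest P n + 1 + 2) * U ≤ (4 : ℝ) ^ (Nat.findGreatest P n + 1 + 2) * 1 :=
          mul_le_mul_of_nonneg_left hU1 (by positivity)
      _ ≤ (4 : ℝ) ^ (2 * nf + (j + 6)) := by rw [mul_one]; exact pow_le_pow_right₀ (by norm_num) (by omega)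
  calc (4 : ℝ) ^ (j + 4) * (16 : ℝ) ^ nf = (4 : ℝ) ^ (j + 4 + 2 * nf) := by
        rw [show (16 : ℝ) = 4 ^ 2 by norm_num, ← pow_mul, ← pow_add]
    _ ≤ (4 : ℝ) ^ Nat.findGreatest P n := pow_le_pow_right₀ (by norm_num) (by omega)

/-! ## §2 The single slice, no window -/

set_option maxHeartbeats 1600000 in -- two large instantiations
/-- **`α_w` of a single slice at the flow frame `K_n`, NO depth window** (see the module docstring): p3's deep-window bound on the window
`4^{n+2}·U ≤ 4^{2nf+j+6}`, the (D5) family+band telescope below it (base index from `exists_base_index_of_not_window`), read at `K_n` through the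
model congruence. [cite: BenfattoGiulianiMastropietro2006, §2.8 (2.81), §3 (3.2)–(3.8)] -/
theorem alphaWt_klSliceCov_bgmFat_klEng_flow_all (j : ℕ) (R : RenConsts) (c'' : ℝ) (hc'' : 0 < c'') :
    ∃ Cα : ℝ, 0 < Cα ∧
      ∀ (G : GeoConsts) (P : SplitConsts) (Q : EngConsts) (cc : ℝ), R.WF2 → 0 < cc → cc ≤ EngineV8.klEngC₃6 P R →
      ∀ μ ∈ klWindowC, ∀ U : ℝ, 0 < U → U ≤ min (EngineV8.klEngU₀3 P R cc) (1 / (R.Gfr 3 + 1)) → c'' * U ≤ 1 →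
      ∀ β : ℝ, klBetaMin ≤ β → β ≤ Real.exp (cc / U ^ 2) →
      ∀ (L M : ℕ) [NeZero L] [NeZero M], EngineV8.klEngL₃ β U ≤ L → EngineV8.klEngM₃ β U L ≤ M →
      ∀ n : ℕ, 1 ≤ n → n ≤ nScales β + 1 → IsKLRegime U cc (-(n : ℤ)) → HistP klPredsV17F2 L M G P Q R β U μ 0 n →
        (∀ m < n, FlowPieceOscAt L M c'' β U μ m) →
        ∀ nf : ℕ, 1 ≤ nf → nf + j ≤ nScales β + 1 → ∀ nw : ℕ, nf + j ≤ nw →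
        (∀ Y : SpaceTimeIdx L M × SectorLeg (sectorCount nf),
          ∑ Y', ‖((sectorSubMatrix L M β (bgmFatMultiplier L M klE0 β (nambuXiCT L μ (klFlowFrameU L M β U μ n)) nf)).transpose *
            klSliceCov L M β μ (klFlowFrameU L M β U μ n) (nf + j) *
            sectorSubMatrix L M β (bgmFatMultiplier L M klE0 β (nambuXiCT L μ (klFlowFrameU L M β U μ n)) nf)) Y Y'‖ *
              EngineV8.klScaleWt L M β nw {EngineV8.latticeLegPos (2 * (2 * M)) Y, EngineV8.latticeLegPos (2 * (2 * M)) Y'} ≤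
            Cα * ((M : ℝ) / β) / klScale klE0 (nf + j)) ∧
        (∀ Y' : SpaceTimeIdx L M × SectorLeg (sectorCount nf),
          ∑ Y, ‖((sectorSubMatrix L M β (bgmFatMultiplier L M klE0 β (nambuXiCT L μ (klFlowFrameU L M β U μ n)) nf)).transpose *
            klSliceCov L M β μ (klFlowFrameU L M β U μ n) (nf + j) *
            sectorSubMatrix L M β (bgmFatMultiplier L M klE0 β (nambuXiCT L μ (klFlowFrameU L M β U μ n)) nf)) Y Y'‖ *
              EngineV8.klScaleWt L M β nw {EngineV8.latticeLegPos (2 * (2 * M)) Y, EngineV8.latticeLegPos (2 * (2 * M)) Y'} ≤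
            Cα * ((M : ℝ) / β) / klScale klE0 (nf + j)) := by
  have ha : (-4 : ℝ) < -(6 / 5) := by norm_num
  have hab : (-(6 / 5) : ℝ) ≤ -(1 / 10) := by norm_num
  have hb : (-(1 / 10) : ℝ) < 0 := by norm_num
  obtain ⟨Cd, hCd, hdeep⟩ := alphaWt_klSliceCov_bgmFat_klEng_flow_deep j (j + 6)
  obtain ⟨C5, hC5, htel⟩ := alphaWt_klSliceCov_bgmFat_klEng_meanFreeFinal j (j + 6) R c'' hc''
  refine ⟨Cd + C5, by positivity, ?_⟩
  intro G P Q cc hR2 hcc hcc6 μ hμ U hU hUle hcU β hβmin hβc L M _ _ hL3 hM3 n hn1 hnN hreg hhist hosc nf hnf hnfN nw hnw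
  have hRj : ∀ i, 0 ≤ R.Gfr i := EngineV8.gfr_nonneg_of_wf2 hR2
  have hU1 : U ≤ 1 :=
    ((hUle.trans (min_le_left _ _)).trans (EngineV8.klEngU₀3_le_symbolU₀ ha hab hb P hRj cc)).trans (min_le_left _ _)
  have hβ0 : 0 < β := pos_of_klBetaMin_le hβmin
  have hM0 : (0 : ℝ) < M := Nat.cast_pos.2 (Nat.pos_of_ne_zero (NeZero.ne M))
  have hΛ : 0 < klScale klE0 (nf + j) := klth_klScale_pos _
  have hunit : 0 ≤ ((M : ℝ) / β) / klScale klE0 (nf + j) := by positivity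
  have hmonoD : Cd * ((M : ℝ) / β) / klScale klE0 (nf + j) ≤ (Cd + C5) * ((M : ℝ) / β) / klScale klE0 (nf + j) := by
    rw [mul_div_assoc, mul_div_assoc]; exact mul_le_mul_of_nonneg_right (by linarith) hunit
  have hmono5 : C5 * ((M : ℝ) / β) / klScale klE0 (nf + j) ≤ (Cd + C5) * ((M : ℝ) / β) / klScale klE0 (nf + j) := by
    rw [mul_div_assoc, mul_div_assoc]; exact mul_le_mul_of_nonneg_right (by linarith) hunit
  by_cases hwin : (4 : ℝ) ^ (n + 2) * U ≤ (4 : ℝ) ^ (2 * nf + (j + 6))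
  · -- on the deep window: p3's bound at `K_n`
    have hfr : FrameOK R U (nScales β) μ (klFlowFrameU L M β U μ n) := frameOK_klFlowFrameU_of_histP_le hR2 hn1 le_rfl hnN hhist
    obtain ⟨hrow, hcol⟩ := hdeep G P R Q cc hR2 hcc hcc6 μ hμ U hU hUle β hβmin hβc L M hL3 hM3 n hn1 hnN hhist hfr nf hnf hnfN hwin nw hnw
    exact ⟨fun Y => (hrow Y).trans hmonoD, fun Y' => (hcol Y').trans hmonoD⟩
  · -- below it: the (D5) telescope from the base index `m₀`, read at `K_n` through the model congruence
    obtain ⟨m₀, hm1, hmn, hwin₀, htw⟩ := exists_base_index_of_not_window hU1 hn1 hnf hwin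
    obtain ⟨hrow, hcol⟩ := htel G P Q cc hR2 hcc hcc6 μ hμ U hU hUle hcU β hβmin hβc L M hL3 hM3 n hnN hreg hhist hosc m₀ hm1 hmn nf hnf hnfN
      hwin₀ htw nw hnw
    have hK : ∀ k : TorusSite 2 L,
        (fsub (klFlowFrameU L M β U μ n) (symInterp L fun _ =>
            ∑ m ∈ Ico n n, klAngularMean (klLocalPart L M β U μ (klFlowFrameU L M β U μ m) m))).eval (latticeMomentum L k) =
          (klFlowFrameU L M β U μ n).eval (latticeMomentum L k) := fun k =>
      eval_fsub_symInterp_sum_Ico_self _ _ n _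
    have hxi := nambuXiCT_congr L μ hK
    have hcov : klSliceCov L M β μ (fsub (klFlowFrameU L M β U μ n) (symInterp L fun _ =>
          ∑ m ∈ Ico n n, klAngularMean (klLocalPart L M β U μ (klFlowFrameU L M β U μ m) m))) (nf + j) =
        klSliceCov L M β μ (klFlowFrameU L M β U μ n) (nf + j) := by
      unfold klSliceCov; exact hubbardCovSliceCT_congr L M β μ 0 _ _ hK
    rw [hxi, hcov] at hrow hcol
    exact ⟨fun Y => (hrow Y).trans hmono5, fun Y' => (hcol Y').trans hmono5⟩


/-! ## §3 The thick-slice block and the tower's indexing, no window -/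

set_option maxHeartbeats 1600000 in -- bookkeeping over the slices of the block (p3's …AlphaWtBlockFlow verbatim over the window-free slices)
/-- **`α_w` of a BLOCK covariance at the flow frame, NO depth window**: the `klScaleWt J′`-weighted rows and columns of
`S(F̃_nf[K_n])ᵀ·C^{K_n}_{(Λ_{J₂},Λ_{nf+1}]}·S(F̃_nf[K_n])` for `nf + 1 ≤ J₂ ≤ nf + 1 + db`, `J₂ ≤ n_β + 1`, `nf + 1 ≤ J′` are `≤ Cb·(M/β)/Λ_{J₂}`
(`Cb = 4^{db}·Σ_{j ≤ db+1} Cα(j, R, c″)`; block = sum of slices `hubbardCovSliceCT_eq_sum_klSliceCov`, stronger weight `klScaleWt_le_pow_mul_klScaleWt`).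
[cite: BenfattoGiulianiMastropietro2006, §2.8 (2.81), §3 (3.3)] -/
theorem alphaWt_blockSliceCT_bgmFat_klEng_flow_all (db : ℕ) (R : RenConsts) (c'' : ℝ) (hc'' : 0 < c'') :
    ∃ Cb : ℝ, 0 < Cb ∧
      ∀ (G : GeoConsts) (P : SplitConsts) (Q : EngConsts) (cc : ℝ), R.WF2 → 0 < cc → cc ≤ EngineV8.klEngC₃6 P R →
      ∀ μ ∈ klWindowC, ∀ U : ℝ, 0 < U → U ≤ min (EngineV8.klEngU₀3 P R cc) (1 / (R.Gfr 3 + 1)) → c'' * U ≤ 1 →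
      ∀ β : ℝ, klBetaMin ≤ β → β ≤ Real.exp (cc / U ^ 2) →
      ∀ (L M : ℕ) [NeZero L] [NeZero M], EngineV8.klEngL₃ β U ≤ L → EngineV8.klEngM₃ β U L ≤ M →
      ∀ n : ℕ, 1 ≤ n → n ≤ nScales β + 1 → IsKLRegime U cc (-(n : ℤ)) → HistP klPredsV17F2 L M G P Q R β U μ 0 n →
        (∀ m < n, FlowPieceOscAt L M c'' β U μ m) →
        ∀ nf : ℕ, 1 ≤ nf → ∀ J₂ : ℕ, nf + 1 ≤ J₂ → J₂ ≤ nf + 1 + db → J₂ ≤ nScales β + 1 → ∀ J' : ℕ, nf + 1 ≤ J' →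
        (∀ Y : SpaceTimeIdx L M × SectorLeg (sectorCount nf),
          ∑ Y', ‖((sectorSubMatrix L M β (bgmFatMultiplier L M klE0 β (nambuXiCT L μ (klFlowFrameU L M β U μ n)) nf)).transpose *
            hubbardCovSliceCT L M β μ 0 (klFlowFrameU L M β U μ n) (klScale klE0 J₂) (klScale klE0 (nf + 1)) *
            sectorSubMatrix L M β (bgmFatMultiplier L M klE0 β (nambuXiCT L μ (klFlowFrameU L M β U μ n)) nf)) Y Y'‖ *
              EngineV8.klScaleWt L M β J' {EngineV8.latticeLegPos (2 * (2 * M)) Y, EngineV8.latticeLegPos (2 * (2 * M)) Y'} ≤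
            Cb * ((M : ℝ) / β) / klScale klE0 J₂) ∧
        (∀ Y' : SpaceTimeIdx L M × SectorLeg (sectorCount nf),
          ∑ Y, ‖((sectorSubMatrix L M β (bgmFatMultiplier L M klE0 β (nambuXiCT L μ (klFlowFrameU L M β U μ n)) nf)).transpose *
            hubbardCovSliceCT L M β μ 0 (klFlowFrameU L M β U μ n) (klScale klE0 J₂) (klScale klE0 (nf + 1)) *
            sectorSubMatrix L M β (bgmFatMultiplier L M klE0 β (nambuXiCT L μ (klFlowFrameU L M β U μ n)) nf)) Y Y'‖ *
              EngineV8.klScaleWt L M β J' {EngineV8.latticeLegPos (2 * (2 * M)) Y, EngineV8.latticeLegPos (2 * (2 * M)) Y'} ≤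
            Cb * ((M : ℝ) / β) / klScale klE0 J₂) := by
  -- the single-slice constants, one per slice offset `j ≤ db + 1`
  have hsl := fun j : ℕ => alphaWt_klSliceCov_bgmFat_klEng_flow_all j R c'' hc''
  choose Cα hCα hbd using hsl
  set Cs : ℝ := ∑ j ∈ range (db + 2), Cα j with hCs
  have hCs0 : 0 < Cs := by
    rw [hCs]; exact Finset.sum_pos (fun j _ => hCα j) ⟨0, Finset.mem_range.2 (by omega)⟩
  refine ⟨(4 : ℝ) ^ db * Cs, by positivity, ?_⟩
  intro G P Q cc hR2 hcc hcc6 μ hμ U hU hUle hcU β hβmin hβc L M _ _ hL3 hM3 n hn1 hnN hreg hhist hosc nf hnf J₂ hJ₁ hJ₂ hJ₂N J' hJ'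
  have hβ0 : 0 < β := pos_of_klBetaMin_le hβmin
  have hM0 : (0 : ℝ) < M := Nat.cast_pos.2 (Nat.pos_of_ne_zero (NeZero.ne M))
  set K : TrigPolyC4v := klFlowFrameU L M β U μ n with hKdef
  set S : Matrix (HubbardFieldIdx L M) (SpaceTimeIdx L M × SectorLeg (sectorCount nf)) ℂ :=
    sectorSubMatrix L M β (bgmFatMultiplier L M klE0 β (nambuXiCT L μ K) nf) with hSdef
  -- the block as a sum of slices
  obtain ⟨t, rfl⟩ : ∃ t, J₂ = nf + 1 + t := ⟨J₂ - (nf + 1), by omega⟩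
  have ht : t ≤ db := by omega
  have hblock : S.transpose * hubbardCovSliceCT L M β μ 0 K (klScale klE0 (nf + 1 + t)) (klScale klE0 (nf + 1)) * S =
      ∑ s ∈ Finset.Ico (nf + 1 + 1) (nf + 1 + t + 1), S.transpose * klSliceCov L M β μ K s * S := by
    rw [hubbardCovSliceCT_eq_sum_klSliceCov, Matrix.mul_sum, Matrix.sum_mul]
  -- per slice `s = nf + j`, `2 ≤ j ≤ t + 1`: the single-slice bound at weight `max J′ s`, then the weight comparison
  have hΛJ₂ : ∀ s ∈ Finset.Ico (nf + 1 + 1) (nf + 1 + t + 1), 1 / klScale klE0 s ≤ 1 / klScale klE0 (nf + 1 + t) := fun s hs =>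
    one_div_le_one_div_of_le (klth_klScale_pos _) (EngineV8.klScale_le_klScale (by norm_num [klE0]) (by
      have := (Finset.mem_Ico.1 hs).2; omega))
  have hper : ∀ s ∈ Finset.Ico (nf + 1 + 1) (nf + 1 + t + 1),
      (∀ Y : SpaceTimeIdx L M × SectorLeg (sectorCount nf),
        ∑ Y', ‖(S.transpose * klSliceCov L M β μ K s * S) Y Y'‖ *
          EngineV8.klScaleWt L M β J' {EngineV8.latticeLegPos (2 * (2 * M)) Y, EngineV8.latticeLegPos (2 * (2 * M)) Y'} ≤
          (4 : ℝ) ^ db * Cα (s - nf) * ((M : ℝ) / β) / klScale klE0 (nf + 1 + t)) ∧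
      (∀ Y' : SpaceTimeIdx L M × SectorLeg (sectorCount nf),
        ∑ Y, ‖(S.transpose * klSliceCov L M β μ K s * S) Y Y'‖ *
          EngineV8.klScaleWt L M β J' {EngineV8.latticeLegPos (2 * (2 * M)) Y, EngineV8.latticeLegPos (2 * (2 * M)) Y'} ≤
          (4 : ℝ) ^ db * Cα (s - nf) * ((M : ℝ) / β) / klScale klE0 (nf + 1 + t)) := by
    intro s hs
    have hs1 := (Finset.mem_Ico.1 hs).1
    have hs2 := (Finset.mem_Ico.1 hs).2
    have hsj : nf + (s - nf) = s := by omega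
    -- the single slice at weight level `nw := max J′ s`
    have h1 := hbd (s - nf) G P Q cc hR2 hcc hcc6 μ hμ U hU hUle hcU β hβmin hβc L M hL3 hM3 n hn1 hnN hreg hhist hosc nf hnf (by omega)
      (max J' s) (by omega)
    rw [hsj] at h1
    obtain ⟨hrow, hcol⟩ := h1
    -- the weight comparison `klScaleWt J′ ≤ 4^{max J′ s − J′}·klScaleWt (max J′ s) ≤ 4^{db}·…`
    have hwt : ∀ T : Finset (ZMod (2 * (2 * M)) × TorusSite 2 L),
        EngineV8.klScaleWt L M β J' T ≤ (4 : ℝ) ^ db * EngineV8.klScaleWt L M β (max J' s) T := by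
      intro T
      refine (klScaleWt_le_pow_mul_klScaleWt β (le_max_left J' s) T).trans ?_
      have hT0 : 0 ≤ EngineV8.klScaleWt L M β (max J' s) T := by
        rw [klScaleWt_apply]; have := labelDiam_nonneg (gridLabelDist L (2 * (2 * M)) β) T
        have := (klth_klScale_pos (max J' s)).le; positivity
      exact mul_le_mul_of_nonneg_right (pow_le_pow_right₀ (by norm_num) (by omega)) hT0
    have hC0 : 0 ≤ Cα (s - nf) * ((M : ℝ) / β) / klScale klE0 s := by
      have := hCα (s - nf); have := klth_klScale_pos s; positivity
    have hup : Cα (s - nf) * ((M : ℝ) / β) / klScale klE0 s ≤ Cα (s - nf) * ((M : ℝ) / β) / klScale klE0 (nf + 1 + t) := by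
      rw [div_eq_mul_one_div, div_eq_mul_one_div (Cα (s - nf) * _)]
      exact mul_le_mul_of_nonneg_left (hΛJ₂ s hs) (by have := hCα (s - nf); positivity)
    constructor
    · intro Y
      calc ∑ Y', ‖(S.transpose * klSliceCov L M β μ K s * S) Y Y'‖ *
            EngineV8.klScaleWt L M β J' {EngineV8.latticeLegPos (2 * (2 * M)) Y, EngineV8.latticeLegPos (2 * (2 * M)) Y'}
          ≤ ∑ Y', ‖(S.transpose * klSliceCov L M β μ K s * S) Y Y'‖ *
            ((4 : ℝ) ^ db * EngineV8.klScaleWt L M β (max J' s) {EngineV8.latticeLegPos (2 * (2 * M)) Y, EngineV8.latticeLegPos (2 * (2 * M)) Y'}) :=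
            Finset.sum_le_sum fun Y' _ => mul_le_mul_of_nonneg_left (hwt _) (norm_nonneg _)
        _ = (4 : ℝ) ^ db * ∑ Y', ‖(S.transpose * klSliceCov L M β μ K s * S) Y Y'‖ *
            EngineV8.klScaleWt L M β (max J' s) {EngineV8.latticeLegPos (2 * (2 * M)) Y, EngineV8.latticeLegPos (2 * (2 * M)) Y'} := by
            rw [Finset.mul_sum]; exact Finset.sum_congr rfl fun Y' _ => by ring
        _ ≤ (4 : ℝ) ^ db * (Cα (s - nf) * ((M : ℝ) / β) / klScale klE0 s) := mul_le_mul_of_nonneg_left (hrow Y) (by positivity)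
        _ ≤ (4 : ℝ) ^ db * (Cα (s - nf) * ((M : ℝ) / β) / klScale klE0 (nf + 1 + t)) := mul_le_mul_of_nonneg_left hup (by positivity)
        _ = (4 : ℝ) ^ db * Cα (s - nf) * ((M : ℝ) / β) / klScale klE0 (nf + 1 + t) := by ring
    · intro Y'
      calc ∑ Y, ‖(S.transpose * klSliceCov L M β μ K s * S) Y Y'‖ *
            EngineV8.klScaleWt L M β J' {EngineV8.latticeLegPos (2 * (2 * M)) Y, EngineV8.latticeLegPos (2 * (2 * M)) Y'}
          ≤ ∑ Y, ‖(S.transpose * klSliceCov L M β μ K s * S) Y Y'‖ *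
            ((4 : ℝ) ^ db * EngineV8.klScaleWt L M β (max J' s) {EngineV8.latticeLegPos (2 * (2 * M)) Y, EngineV8.latticeLegPos (2 * (2 * M)) Y'}) :=
            Finset.sum_le_sum fun Y _ => mul_le_mul_of_nonneg_left (hwt _) (norm_nonneg _)
        _ = (4 : ℝ) ^ db * ∑ Y, ‖(S.transpose * klSliceCov L M β μ K s * S) Y Y'‖ *
            EngineV8.klScaleWt L M β (max J' s) {EngineV8.latticeLegPos (2 * (2 * M)) Y, EngineV8.latticeLegPos (2 * (2 * M)) Y'} := by
            rw [Finset.mul_sum]; exact Finset.sum_congr rfl fun Y _ => by ring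
        _ ≤ (4 : ℝ) ^ db * (Cα (s - nf) * ((M : ℝ) / β) / klScale klE0 s) := mul_le_mul_of_nonneg_left (hcol Y') (by positivity)
        _ ≤ (4 : ℝ) ^ db * (Cα (s - nf) * ((M : ℝ) / β) / klScale klE0 (nf + 1 + t)) := mul_le_mul_of_nonneg_left hup (by positivity)
        _ = (4 : ℝ) ^ db * Cα (s - nf) * ((M : ℝ) / β) / klScale klE0 (nf + 1 + t) := by ring
  -- the sum of the per-slice constants is at most `Cs`
  have hsumC : ∑ s ∈ Finset.Ico (nf + 1 + 1) (nf + 1 + t + 1), (4 : ℝ) ^ db * Cα (s - nf) * ((M : ℝ) / β) / klScale klE0 (nf + 1 + t) ≤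
      (4 : ℝ) ^ db * Cs * ((M : ℝ) / β) / klScale klE0 (nf + 1 + t) := by
    have e : ∑ s ∈ Finset.Ico (nf + 1 + 1) (nf + 1 + t + 1), (4 : ℝ) ^ db * Cα (s - nf) * ((M : ℝ) / β) / klScale klE0 (nf + 1 + t) =
        (4 : ℝ) ^ db * (∑ s ∈ Finset.Ico (nf + 1 + 1) (nf + 1 + t + 1), Cα (s - nf)) * ((M : ℝ) / β) / klScale klE0 (nf + 1 + t) := by
      rw [Finset.mul_sum, Finset.sum_mul, Finset.sum_div]
    rw [e]
    have hΛ0 : 0 < klScale klE0 (nf + 1 + t) := klth_klScale_pos _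
    have hsub : ∑ s ∈ Finset.Ico (nf + 1 + 1) (nf + 1 + t + 1), Cα (s - nf) ≤ Cs := by
      rw [hCs]
      have himg : ∑ s ∈ Finset.Ico (nf + 1 + 1) (nf + 1 + t + 1), Cα (s - nf) = ∑ j ∈ Finset.Ico 2 (t + 2), Cα j := by
        have e1 : Finset.Ico (nf + 1 + 1) (nf + 1 + t + 1) = (Finset.Ico 2 (t + 2)).map (addRightEmbedding nf) := by
          rw [Finset.map_add_right_Ico]; congr 1 <;> ring
        rw [e1, Finset.sum_map]
        refine Finset.sum_congr rfl fun j _ => ?_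
        simp [addRightEmbedding]
      rw [himg]
      exact Finset.sum_le_sum_of_subset_of_nonneg (fun j hj => by
        have := Finset.mem_Ico.1 hj; exact Finset.mem_range.2 (by omega)) (fun j _ _ => (hCα j).le)
    have hMβ0 : 0 ≤ (M : ℝ) / β := by positivity
    exact div_le_div_of_nonneg_right (mul_le_mul_of_nonneg_right (mul_le_mul_of_nonneg_left hsub (by positivity)) hMβ0) hΛ0.le
  -- assemble: entries of the sum, norms subadditive, sums swapped
  refine ⟨fun Y => ?_, fun Y' => ?_⟩
  · rw [hblock]
    calc ∑ Y', ‖(∑ s ∈ Finset.Ico (nf + 1 + 1) (nf + 1 + t + 1), S.transpose * klSliceCov L M β μ K s * S) Y Y'‖ *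
          EngineV8.klScaleWt L M β J' {EngineV8.latticeLegPos (2 * (2 * M)) Y, EngineV8.latticeLegPos (2 * (2 * M)) Y'}
        ≤ ∑ Y', ∑ s ∈ Finset.Ico (nf + 1 + 1) (nf + 1 + t + 1), ‖(S.transpose * klSliceCov L M β μ K s * S) Y Y'‖ *
          EngineV8.klScaleWt L M β J' {EngineV8.latticeLegPos (2 * (2 * M)) Y, EngineV8.latticeLegPos (2 * (2 * M)) Y'} := by
          refine Finset.sum_le_sum fun Y' _ => ?_
          rw [Matrix.sum_apply, ← Finset.sum_mul]
          refine mul_le_mul_of_nonneg_right (norm_sum_le _ _) ?_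
          rw [klScaleWt_apply]; have := labelDiam_nonneg (gridLabelDist L (2 * (2 * M)) β)
            {EngineV8.latticeLegPos (2 * (2 * M)) Y, EngineV8.latticeLegPos (2 * (2 * M)) Y'}
          have := (klth_klScale_pos J').le; positivity
      _ = ∑ s ∈ Finset.Ico (nf + 1 + 1) (nf + 1 + t + 1), ∑ Y', ‖(S.transpose * klSliceCov L M β μ K s * S) Y Y'‖ *
          EngineV8.klScaleWt L M β J' {EngineV8.latticeLegPos (2 * (2 * M)) Y, EngineV8.latticeLegPos (2 * (2 * M)) Y'} := Finset.sum_comm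
      _ ≤ ∑ s ∈ Finset.Ico (nf + 1 + 1) (nf + 1 + t + 1), (4 : ℝ) ^ db * Cα (s - nf) * ((M : ℝ) / β) / klScale klE0 (nf + 1 + t) :=
          Finset.sum_le_sum fun s hs => (hper s hs).1 Y
      _ ≤ (4 : ℝ) ^ db * Cs * ((M : ℝ) / β) / klScale klE0 (nf + 1 + t) := hsumC
  · rw [hblock]
    calc ∑ Y, ‖(∑ s ∈ Finset.Ico (nf + 1 + 1) (nf + 1 + t + 1), S.transpose * klSliceCov L M β μ K s * S) Y Y'‖ *
          EngineV8.klScaleWt L M β J' {EngineV8.latticeLegPos (2 * (2 * M)) Y, EngineV8.latticeLegPos (2 * (2 * M)) Y'}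
        ≤ ∑ Y, ∑ s ∈ Finset.Ico (nf + 1 + 1) (nf + 1 + t + 1), ‖(S.transpose * klSliceCov L M β μ K s * S) Y Y'‖ *
          EngineV8.klScaleWt L M β J' {EngineV8.latticeLegPos (2 * (2 * M)) Y, EngineV8.latticeLegPos (2 * (2 * M)) Y'} := by
          refine Finset.sum_le_sum fun Y _ => ?_
          rw [Matrix.sum_apply, ← Finset.sum_mul]
          refine mul_le_mul_of_nonneg_right (norm_sum_le _ _) ?_
          rw [klScaleWt_apply]; have := labelDiam_nonneg (gridLabelDist L (2 * (2 * M)) β)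
            {EngineV8.latticeLegPos (2 * (2 * M)) Y, EngineV8.latticeLegPos (2 * (2 * M)) Y'}
          have := (klth_klScale_pos J').le; positivity
      _ = ∑ s ∈ Finset.Ico (nf + 1 + 1) (nf + 1 + t + 1), ∑ Y, ‖(S.transpose * klSliceCov L M β μ K s * S) Y Y'‖ *
          EngineV8.klScaleWt L M β J' {EngineV8.latticeLegPos (2 * (2 * M)) Y, EngineV8.latticeLegPos (2 * (2 * M)) Y'} := Finset.sum_comm
      _ ≤ ∑ s ∈ Finset.Ico (nf + 1 + 1) (nf + 1 + t + 1), (4 : ℝ) ^ db * Cα (s - nf) * ((M : ℝ) / β) / klScale klE0 (nf + 1 + t) :=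
          Finset.sum_le_sum fun s hs => (hper s hs).2 Y'
      _ ≤ (4 : ℝ) ^ db * Cs * ((M : ℝ) / β) / klScale klE0 (nf + 1 + t) := hsumC

/-- **The block rows in the tower's indexing, NO depth window**: `alphaWt_blockSliceCT_bgmFat_klEng_flow_all db R c″` at `nf := d·k − 1`, `J₂ := d·(k+1)`,
`db := d`, `J′ := j` — E1's `hrow/hcol` of `klWtPinnedSumAt_klTowerIncr_le` at EVERY block `k ≥ 1` (`2 ≤ dk`, `d(k+1) ≤ n_β + 1`, `dk ≤ j`).
[cite: BenfattoGiulianiMastropietro2006, §2.8 (2.81), §3 (3.3)] -/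
theorem alphaWt_towerBlock_klEng_flow_all (d : ℕ) (R : RenConsts) (c'' : ℝ) (hc'' : 0 < c'') :
    ∃ Cb : ℝ, 0 < Cb ∧
      ∀ (G : GeoConsts) (P : SplitConsts) (Q : EngConsts) (cc : ℝ), R.WF2 → 0 < cc → cc ≤ EngineV8.klEngC₃6 P R →
      ∀ μ ∈ klWindowC, ∀ U : ℝ, 0 < U → U ≤ min (EngineV8.klEngU₀3 P R cc) (1 / (R.Gfr 3 + 1)) → c'' * U ≤ 1 →
      ∀ β : ℝ, klBetaMin ≤ β → β ≤ Real.exp (cc / U ^ 2) →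
      ∀ (L M : ℕ) [NeZero L] [NeZero M], EngineV8.klEngL₃ β U ≤ L → EngineV8.klEngM₃ β U L ≤ M →
      ∀ n : ℕ, 1 ≤ n → n ≤ nScales β + 1 → IsKLRegime U cc (-(n : ℤ)) → HistP klPredsV17F2 L M G P Q R β U μ 0 n →
        (∀ m < n, FlowPieceOscAt L M c'' β U μ m) →
        ∀ k : ℕ, 1 ≤ k → 2 ≤ d * k → d * (k + 1) ≤ nScales β + 1 → ∀ j : ℕ, d * k ≤ j →
        (∀ Y : SpaceTimeIdx L M × SectorLeg (sectorCount (d * k - 1)),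
          ∑ Y', ‖((sectorSubMatrix L M β (bgmFatMultiplier L M klE0 β (nambuXiCT L μ (klFlowFrameU L M β U μ n)) (d * k - 1))).transpose *
            hubbardCovSliceCT L M β μ 0 (klFlowFrameU L M β U μ n) (klScale klE0 (d * (k + 1))) (klScale klE0 (d * k)) *
            sectorSubMatrix L M β (bgmFatMultiplier L M klE0 β (nambuXiCT L μ (klFlowFrameU L M β U μ n)) (d * k - 1))) Y Y'‖ *
              EngineV8.klScaleWt L M β j {EngineV8.latticeLegPos (2 * (2 * M)) Y, EngineV8.latticeLegPos (2 * (2 * M)) Y'} ≤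
            Cb * ((M : ℝ) / β) / klScale klE0 (d * (k + 1))) ∧
        (∀ Y' : SpaceTimeIdx L M × SectorLeg (sectorCount (d * k - 1)),
          ∑ Y, ‖((sectorSubMatrix L M β (bgmFatMultiplier L M klE0 β (nambuXiCT L μ (klFlowFrameU L M β U μ n)) (d * k - 1))).transpose *
            hubbardCovSliceCT L M β μ 0 (klFlowFrameU L M β U μ n) (klScale klE0 (d * (k + 1))) (klScale klE0 (d * k)) *
            sectorSubMatrix L M β (bgmFatMultiplier L M klE0 β (nambuXiCT L μ (klFlowFrameU L M β U μ n)) (d * k - 1))) Y Y'‖ *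
              EngineV8.klScaleWt L M β j {EngineV8.latticeLegPos (2 * (2 * M)) Y, EngineV8.latticeLegPos (2 * (2 * M)) Y'} ≤
            Cb * ((M : ℝ) / β) / klScale klE0 (d * (k + 1))) := by
  obtain ⟨Cb, hCb, h⟩ := alphaWt_blockSliceCT_bgmFat_klEng_flow_all d R c'' hc''
  refine ⟨Cb, hCb, ?_⟩
  intro G P Q cc hR2 hcc hcc6 μ hμ U hU hUle hcU β hβmin hβc L M _ _ hL3 hM3 n hn1 hnN hreg hhist hosc k hk hdk hkN j hj
  have e1 : d * k - 1 + 1 = d * k := by omega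
  have h' := h G P Q cc hR2 hcc hcc6 μ hμ U hU hUle hcU β hβmin hβc L M hL3 hM3 n hn1 hnN hreg hhist hosc (d * k - 1) (by omega) (d * (k + 1))
    (by rw [e1]; exact Nat.mul_le_mul_left d (Nat.le_succ k)) (by rw [e1, Nat.mul_succ]) hkN j (by omega)
  rw [e1] at h'
  exact h'

end Summit.HubbardSuperconductivity.HubbardSuperconductivity.Theorems.TorusFourierL2

end
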